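import Summits.QuantumFields.BalabanUV.T4Continuum.Support.ShellMeasureWilsonRealizedSU2Words
import Literature.MathematicalPhysics.QuantumFieldTheory.Balaban1983to89.MissingProofs

/-!
# `T4Continuum.ShellMeasureWilsonRealizedSU2` — (M1)₀ REALIZED for `G = SU(2)`, file 2 of 2: the windowed, sectioned
# Wilson block weight on the cell's configuration space `(fieldMeasure P j SU2).withDensity F` and the verbatim
# classifier `max_p dist1 U(∂p)` satisfy `T4ShellMeasure.SlotAntiConcentration` — no analytic binder left
# (cell `pub-balaban`, sub-cell `t4`, spine estimate NE7c (node U5b); lineage t4-ne7c-p1 = PROVER seat P1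
# «shell-measure route», generation 25; successor task (0-a) of record v3.13 §5 executed, file 2 of 2; ADDITIVE —
# imports `ShellMeasureWilsonRealizedSU2Words` and the tree's `MissingProofs` (measurability of `U ↦ U(∂p)`) only)

HONEST FRAMING.  Finite four-torus programme, rung (B)+1 only — NOT infinite volume, NOT a mass gap, NOT the Clay
problem, NOT summit progress; (B), `BetaPertHyp`, (B^μ) not consumed.  (M1) for BAŁABAN'S INDUCTIVELY DEFINED
EFFECTIVE MEASURES is NOT PRINTED (GAPS G-ne7cp1-1) and NOT moved: this is the LEVEL-0 instance (bare Wilson step: the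
tested variable of B14 (2.17) is the bare plaquette field `U_{0,□}(V) = V`, the weight is the Wilson weight of B12
(0.2)), WITH the small-field window placed on the block's BOND variables (the located (LR) «window insertion after the
axial gauge» is ASSUMED in the form of the weight, not proved) and WITHOUT exterior co-tests (the located (MR)
untouched; the frozen exterior is arbitrary, so each exterior letter's deviation is bounded by `2`, not by a small-field
size — hence the constant below is linear, not quadratic, in `S`).  Level 0 is in NE7c's live window only for `K ≤ N₁`.
0 sorry, 0 citations; the series enters only through the DEFINITIONS `Setup.plaqHol`, `1 − reTr`, `dist1` (B12 (0.2),
B7 (19)) and the cell's `UnitaryModel` instances, by `rfl`.  HONEST DEPENDENCY (cell): continuum YM on T⁴ ⇐ BetaPertH ∧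
nine spine estimates (0/9 proved); BetaPertH ⇐ (D1) ∧ (D4) ∧ CAP+tail; G-an2-4 gates asym, D1 and NE2/3/4.

THE THEOREM (`slotAntiConcentration_wilson_su2`).  Lattice `T^{(j)}` of the cell (`Params P`, any `j`), `G = SU(2)`;
a block `Λ` of bonds with an enumeration `e` of its `n = 3·#Λ` exponential-chart coordinates; window half-side
`0 < S ≤ 1/8` (`3S² < π²`); classifier plaquettes `P_u ≠ ∅` with all four bonds in `Λ`; weight plaquettes `P_w`;
`β ≥ 0`; `θ > 0`, `0 ≤ δ < 1`, `0 ≤ ρ ≤ (1−δ)/2`; (SM)₀ `4·(8S)²·e^{16S} ≤ δθ`.  WEIGHT `wilsonF`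
`= χ_{Λ,1,S}(U) · exp(−β Σ_{p∈P_w}(1 − reTr U(∂p)))`, CLASSIFIER `wilsonU = max_{p∈P_u} dist1 U(∂p)`.  CONCLUSION:
`SlotAntiConcentration ((fieldMeasure P j SU2).withDensity wilsonF) wilsonU θ ρ (2·(n + β·#P_w·8S·(8 + 32S))/(1−δ))`.
PROOF = `ShellMeasureScalingSU2.slotAntiConcentration_realized_su2_of_coreMap` with (S-i)₀ `coreMap_sup` and (S-ii)₀
`wilsonAction_contract_sub_le`, after the dictionary of file 1 (`coe_plaqHol_eq_wordEval`, `wordEval_plaqWord_smul`).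

WHAT THIS DOES NOT DO.  (LR)₀, (MR)₀, anything at `j ≥ 1`; NE7c NOT proved; 0/9 spine.
-/
noncomputable section

open NormedSpace Set Function MeasureTheory

namespace Summit.QuantumFields.BalabanUV.T4Continuum.ShellMeasureWilsonRealizedSU2

open scoped ENNReal Matrix.Norms.L2Operator
open Literature.MathematicalPhysics.QuantumFieldTheory.Balaban1983to89
open T4ShellMeasure (SlotAntiConcentration)
open T4CubePoincare (cube)
open T4CubeChartGnomonic (SU2)
open T4CubeChartExp (expFibreChart expWindowDensity measurable_expWindowDensity expWindowDensity_nonneg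
  expWindowDensity_le_one expWindowDensity_blind)
open T4ShellMeasureDet (blockLaw)
open ShellMeasureWilsonWords (scale normSum wordExp coreMap_sup interpConst_mono depth_admissible normSum_nonneg scale_one)
open ShellMeasureWilsonTrace (Letter wordEval sGen dFro TraceData)
open ShellMeasureWilsonBlock (matrixTrace matrixTrace_N wilsonAction_contract_sub_le wilson_dictionary_specialUnitaryGroup)
open ShellMeasureScalingSU2 (slotAntiConcentration_realized_su2_of_coreMap)

variable {P : Params} {j : ℕ} [DecidableEq (PBond P j)]
variable (Λ : Finset (PBond P j)) {n : ℕ} (e : ↥Λ × Fin 3 ≃ Fin n)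

/-! ## §2 The realized objects: sectioned Wilson weight, windowed density, classifier -/

/-- THE SECTIONED WILSON WEIGHT of the block at exterior `V`: `R V y = exp(−β Σ_{p∈P_w} (1 − reTr (V[Λ := y])(∂p)))`.
[folklore] -/
def wilsonR (β : ℝ) (Pw : Finset (Plaq P j)) (V : GaugeField P j SU2) (y : ↥Λ → SU2) : ℝ≥0∞ :=
  ENNReal.ofReal (Real.exp (-(β * ∑ p ∈ Pw, (1 - reTr (GaugeField.plaqHol (updateFinset V Λ y) p)))))

/-- THE REALIZED DENSITY: the product exponential window of half-side `S` about `1` on the block bonds times the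
sectioned Wilson weight (exterior bonds free). [folklore] -/
def wilsonF (S β : ℝ) (Pw : Finset (Plaq P j)) (V : GaugeField P j SU2) : ℝ≥0∞ :=
  ENNReal.ofReal (expWindowDensity Λ 1 S V) *
    ENNReal.ofReal (Real.exp (-(β * ∑ p ∈ Pw, (1 - reTr (GaugeField.plaqHol V p)))))

/-- THE VERBATIM LEVEL-0 CLASSIFIER `u(V) = max_{p ∈ P_u} dist1 V(∂p)` (B14 (2.17) at `k = 0`, operator norm). [folklore] -/
def wilsonU {Pu : Finset (Plaq P j)} (hPu : Pu.Nonempty) (V : GaugeField P j SU2) : ℝ :=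
  Pu.sup' hPu fun p => dist1 (GaugeField.plaqHol V p)

omit [DecidableEq (PBond P j)] in
/-- the Wilson sum is measurable. [folklore] -/
theorem measurable_wilsonSum (Pw : Finset (Plaq P j)) :
    Measurable fun V : GaugeField P j SU2 => ∑ p ∈ Pw, (1 - reTr (GaugeField.plaqHol V p)) := by
  refine Finset.measurable_sum _ fun p _ => ?_
  exact measurable_const.sub (RegularGaugeGroup.measurable_reTr.comp (Missing.measurable_plaqHol p))

omit [DecidableEq (PBond P j)] in
/-- the Wilson sum is non-negative. [folklore] -/
theorem wilsonSum_nonneg (Pw : Finset (Plaq P j)) (V : GaugeField P j SU2) :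
    0 ≤ ∑ p ∈ Pw, (1 - reTr (GaugeField.plaqHol V p)) :=
  Finset.sum_nonneg fun _ _ => sub_nonneg.2 (GaugeGroup.reTr_le_one _)

/-- `R V` is measurable. [folklore] -/
theorem measurable_wilsonR (β : ℝ) (Pw : Finset (Plaq P j)) (V : GaugeField P j SU2) :
    Measurable (wilsonR Λ β Pw V) := by
  unfold wilsonR
  refine ENNReal.measurable_ofReal.comp (Real.measurable_exp.comp ?_)
  exact ((measurable_const.mul ((measurable_wilsonSum Pw).comp measurable_updateFinset))).neg

omit [DecidableEq (PBond P j)] in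
/-- `F` is measurable. [folklore] -/
theorem measurable_wilsonF (S β : ℝ) (Pw : Finset (Plaq P j)) : Measurable (wilsonF Λ S β Pw) := by
  unfold wilsonF
  refine (ENNReal.measurable_ofReal.comp (measurable_expWindowDensity Λ 1 S)).mul ?_
  exact ENNReal.measurable_ofReal.comp (Real.measurable_exp.comp ((measurable_const.mul (measurable_wilsonSum Pw))).neg)

omit [DecidableEq (PBond P j)] in
/-- `u` is measurable. [folklore] -/
theorem measurable_wilsonU {Pu : Finset (Plaq P j)} (hPu : Pu.Nonempty) : Measurable (wilsonU hPu (P := P) (j := j)) := by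
  have h : wilsonU hPu (P := P) (j := j) =
      Pu.sup' hPu (fun p => fun V : GaugeField P j SU2 => dist1 (GaugeField.plaqHol V p)) := by
    funext V; simp [wilsonU, Finset.sup'_apply]
  rw [h]
  exact Finset.measurable_sup' hPu fun p _ => RegularGaugeGroup.measurable_dist1.comp (Missing.measurable_plaqHol p)

/-- THE WINDOW FACTORISATION `hFw` of the realized headline, by the blindness of the product window to the exterior.
[folklore] -/
theorem wilsonF_updateFinset (S β : ℝ) (Pw : Finset (Plaq P j)) (V : GaugeField P j SU2) (y : ↥Λ → SU2) :
    wilsonF Λ S β Pw (updateFinset V Λ y) =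
      ENNReal.ofReal (expWindowDensity Λ ((fun _ => (1 : GaugeField P j SU2)) V) S
        (updateFinset ((fun _ => (1 : GaugeField P j SU2)) V) Λ y)) * wilsonR Λ β Pw V y := by
  unfold wilsonF wilsonR
  rw [expWindowDensity_blind]

omit [DecidableEq (PBond P j)] in
/-- the realized density is at most `1` (`β ≥ 0`). [folklore] -/
theorem wilsonF_le_one {S β : ℝ} (hβ : 0 ≤ β) (Pw : Finset (Plaq P j)) (V : GaugeField P j SU2) :
    wilsonF Λ S β Pw V ≤ 1 := by
  unfold wilsonF
  have h1 : ENNReal.ofReal (expWindowDensity Λ 1 S V) ≤ 1 :=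
    ENNReal.ofReal_le_one.2 (expWindowDensity_le_one V)
  have h2 : ENNReal.ofReal (Real.exp (-(β * ∑ p ∈ Pw, (1 - reTr (GaugeField.plaqHol V p))))) ≤ 1 := by
    rw [ENNReal.ofReal_le_one, Real.exp_le_one_iff, neg_nonpos]
    exact mul_nonneg hβ (wilsonSum_nonneg Pw V)
  calc _ ≤ (1 : ℝ≥0∞) * 1 := mul_le_mul' h1 h2
    _ = 1 := one_mul _

/-- per-section finiteness `hfin` of the realized headline. [folklore] -/
theorem wilsonF_section_fin {S β : ℝ} (hβ : 0 ≤ β) (Pw : Finset (Plaq P j)) (V : GaugeField P j SU2) :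
    ((blockLaw Λ).withDensity fun y : ↥Λ → SU2 => wilsonF Λ S β Pw (updateFinset V Λ y)) univ ≠ ∞ := by
  rw [withDensity_apply _ MeasurableSet.univ, Measure.restrict_univ]
  refine ne_top_of_le_ne_top (b := (blockLaw (G := SU2) Λ) univ) (measure_ne_top _ _) ?_
  calc ∫⁻ y, wilsonF Λ S β Pw (updateFinset V Λ y) ∂blockLaw Λ ≤ ∫⁻ _y, 1 ∂blockLaw (G := SU2) Λ :=
        lintegral_mono fun y => wilsonF_le_one Λ hβ Pw _
    _ = (blockLaw (G := SU2) Λ) univ := lintegral_one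

/-! ## §3 Dictionary: the realized action and classifier on the fibre are the sectioned words -/

/-- the Wilson energy of the sectioned configuration at `chart (c • x)` is the word energy at parameter `c`.
[folklore] -/
theorem wilsonSum_chart_smul (Pw : Finset (Plaq P j)) (V : GaugeField P j SU2) (x : Fin n → ℝ) (c : ℝ) :
    ∑ p ∈ Pw, (1 - reTr (GaugeField.plaqHol (updateFinset V Λ (expFibreChart Λ 1 e (c • x))) p)) =
      ∑ p ∈ Pw, (1 - (matrixTrace (n := Fin 2)).τ (wordEval c (plaqWord Λ e V x p)) / (matrixTrace (n := Fin 2)).N) := by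
  refine Finset.sum_congr rfl fun p _ => ?_
  rw [← (wilson_dictionary_specialUnitaryGroup _).1, coe_plaqHol_eq_wordEval, wordEval_plaqWord_smul]

variable [DecidableEq (Plaq P j)]

/-- the classifier of the sectioned configuration at `chart (c • x)`, for INTERIOR plaquettes, is the max of the
scaled words of exponentials. [folklore] -/
theorem wilsonU_chart_smul {Pu : Finset (Plaq P j)} (hPu : Pu.Nonempty)
    (hPuΛ : ∀ p ∈ Pu, (⟨p.src, p.μ⟩ : PBond P j) ∈ Λ ∧ (⟨p.src.shift p.μ, p.ν⟩ : PBond P j) ∈ Λ ∧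
      (⟨p.src.shift p.ν, p.μ⟩ : PBond P j) ∈ Λ ∧ (⟨p.src, p.ν⟩ : PBond P j) ∈ Λ)
    (V : GaugeField P j SU2) (x : Fin n → ℝ) (c : ℝ) :
    wilsonU hPu (updateFinset V Λ (expFibreChart Λ 1 e (c • x))) =
      Pu.sup' hPu fun p => ‖wordExp (scale c (if hp : p ∈ Pu then
        gens Λ e p (hPuΛ p hp).1 (hPuΛ p hp).2.1 (hPuΛ p hp).2.2.1 (hPuΛ p hp).2.2.2 x else [])) - 1‖ := by
  unfold wilsonU
  refine Finset.sup'_congr hPu rfl fun p hp => ?_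
  rw [dif_pos hp, ← (wilson_dictionary_specialUnitaryGroup _).2, coe_plaqHol_eq_wordEval, wordEval_plaqWord_smul,
    wordEval_plaqWord_eq_wordExp]

/-! ## §4 (M1)₀ realized -/

/-- **(M1)₀ REALIZED FOR `G = SU(2)`** — see the module docstring. [folklore] -/
theorem slotAntiConcentration_wilson_su2 (e : ↥Λ × Fin 3 ≃ Fin n) {S : ℝ} (hS : 0 < S) (hS8 : S ≤ 1 / 8) (hSπ : 3 * S ^ 2 < Real.pi ^ 2)
    {Pu : Finset (Plaq P j)} (hPu : Pu.Nonempty)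
    (hPuΛ : ∀ p ∈ Pu, (⟨p.src, p.μ⟩ : PBond P j) ∈ Λ ∧ (⟨p.src.shift p.μ, p.ν⟩ : PBond P j) ∈ Λ ∧
      (⟨p.src.shift p.ν, p.μ⟩ : PBond P j) ∈ Λ ∧ (⟨p.src, p.ν⟩ : PBond P j) ∈ Λ)
    (Pw : Finset (Plaq P j)) {β θ δ ρ : ℝ} (hβ : 0 ≤ β) (hθ : 0 < θ) (hδ0 : 0 ≤ δ) (hδ1 : δ < 1) (hρ0 : 0 ≤ ρ)
    (hρ : ρ ≤ (1 - δ) / 2) (hSM : 4 * (8 * S) ^ 2 * Real.exp (2 * (8 * S)) ≤ δ * θ) :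
    SlotAntiConcentration ((fieldMeasure P j SU2).withDensity (wilsonF Λ S β Pw)) (wilsonU hPu) θ ρ
      (2 * ((n : ℝ) + β * ∑ _p ∈ Pw, (8 * S) * (8 + 4 * (8 * S))) / (1 - δ)) := by
  -- the depth
  have h1δ : 0 < 1 - δ := by linarith
  set ρ' := ρ / (1 - δ) with hρ'
  have hρ'0 : 0 ≤ ρ' := div_nonneg hρ0 h1δ.le
  have hρ'2 : ρ' ≤ 1 / 2 := by rw [hρ', div_le_iff₀ h1δ]; linarith
  set a := -Real.log (1 - ρ') with ha
  have hc0 : 0 < 1 - ρ' := by linarith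
  have hc1 : 1 - ρ' ≤ 1 := by linarith
  have hexp : Real.exp (-a) = 1 - ρ' := by rw [ha, neg_neg, Real.exp_log hc0]
  have ha0 : 0 ≤ a := by rw [ha, neg_nonneg]; exact Real.log_nonpos hc0.le hc1
  have ha2 : a ≤ 2 * ρ' := T4ShellMeasureFibre.neg_log_one_sub_le hρ'0 hρ'2
  have h1ca : 1 - (1 - ρ') ≤ a := by
    have h := Real.log_le_sub_one_of_pos hc0
    rw [ha]; linarith
  set Bf := β * ∑ _p ∈ Pw, (8 * S) * (8 + 4 * (8 * S)) with hBf
  have hBf0 : 0 ≤ Bf := by rw [hBf]; exact mul_nonneg hβ (Finset.sum_nonneg fun p _ => by positivity)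
  have hN : 0 < (matrixTrace (n := Fin 2)).N := ShellMeasureWilsonBlock.matrixTrace_N_pos
  refine slotAntiConcentration_realized_su2_of_coreMap Λ e hS hSπ (fun _ => (1 : GaugeField P j SU2))
    (R := wilsonR Λ β Pw) (measurable_wilsonR Λ β Pw) (F := wilsonF Λ S β Pw) (measurable_wilsonF Λ S β Pw)
    (wilsonF_updateFinset Λ S β Pw) (fun V => wilsonF_section_fin Λ hβ Pw V) (measurable_wilsonU hPu)
    (a := a) (Bf := Bf) hθ.le hρ0 ha0 ?_ ?_ ?_
  · -- the constant
    have hn : (0 : ℝ) ≤ n + Bf := by positivity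
    calc ((n : ℝ) + Bf) * a ≤ (n + Bf) * (2 * ρ') := mul_le_mul_of_nonneg_left ha2 hn
      _ = 2 * (n + Bf) / (1 - δ) * ρ := by rw [hρ']; field_simp
  · -- (S-i)₀ the core map
    intro V x hx _ hux
    rw [hexp]
    have h1 : wilsonU hPu (updateFinset V Λ (expFibreChart Λ 1 e x)) =
        wilsonU hPu (updateFinset V Λ (expFibreChart Λ 1 e ((1 : ℝ) • x))) := by rw [one_smul]
    rw [h1, wilsonU_chart_smul Λ e hPu hPuΛ] at hux
    rw [wilsonU_chart_smul Λ e hPu hPuΛ]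
    simp only [scale_one] at hux
    refine coreMap_sup hPu _ (δ := δ) hc0 hc1 (fun p hp => ?_) hθ (fun p hp => ?_) ?_ hux
    · rw [dif_pos hp]
      exact (normSum_gens_le Λ e hS.le hx p _ _ _ _).trans (by linarith)
    · rw [dif_pos hp]
      exact (interpConst_mono (normSum_nonneg _) (normSum_gens_le Λ e hS.le hx p _ _ _ _)).trans hSM
    · rw [hρ']; exact depth_admissible hδ0 hδ1 hρ0
  · -- (S-ii)₀ the ray-weight loss of the sectioned Wilson weight
    intro V x hx _ _
    rw [hexp]
    unfold wilsonR
    have h1 : expFibreChart Λ 1 e x = expFibreChart Λ 1 e ((1 : ℝ) • x) := by rw [one_smul]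
    rw [h1, wilsonSum_chart_smul, wilsonSum_chart_smul]
    obtain hdata := fun p => plaqWord_data Λ e hS.le V hx p
    have hdiff := wilsonAction_contract_sub_le (matrixTrace (n := Fin 2)) hN Pw (fun p => plaqWord Λ e V x p)
      (fun p _ => (hdata p).1) (sb := fun _ => 8 * S) (db := fun _ => 8) (fun p _ => (hdata p).2.1)
      (fun p _ => by linarith) (fun p _ => (hdata p).2.2) hβ hc0.le hc1
    rw [← hBf] at hdiff
    have hle : β * ∑ p ∈ Pw, (1 - (matrixTrace (n := Fin 2)).τ (wordEval (1 - ρ') (plaqWord Λ e V x p)) /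
          (matrixTrace (n := Fin 2)).N) -
        β * ∑ p ∈ Pw, (1 - (matrixTrace (n := Fin 2)).τ (wordEval 1 (plaqWord Λ e V x p)) /
          (matrixTrace (n := Fin 2)).N) ≤ Bf * a :=
      hdiff.trans (by nlinarith)
    rw [← ENNReal.ofReal_mul (Real.exp_pos _).le, ← Real.exp_add]
    exact ENNReal.ofReal_le_ofReal (Real.exp_le_exp.2 (by linarith))

end Summit.QuantumFields.BalabanUV.T4Continuum.ShellMeasureWilsonRealizedSU2
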